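import Summits.ResolutionOfSingularities.ResolutionOfSingularities.Theorems.EquisingularLiftEquisingularLiftNatClusterLiftManyPoints
import Mathlib
import HarnessLib

/-!
# [OURS · L1 W4.5(b)] T-CLUSTER-LIFT part 5 — THE MULTI-CHART (coordinate-free) FORM: pairwise distinct points of `ℙ(k[T_σ])`, each
# read on ITS OWN chart, with `Σ_t m_t ≤ d + 1` impose independent conditions on degree-`d` forms; hence the lift of order `≥ m_t`
# along every section of such a cluster of `O`-points (crux `EquisingularLiftNat` = stmt-ResolutionOfSingularities-20038, line `sections`; v7′)

NOT a statement of any manuscript. Helper file of the chain res-L1-w45b (cell `res-hironaka`, LADDER-RESOLUTION rung L, slot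
W4.5(b)); OURS; AI-written, weaker than expert review; `--supports stmt-ResolutionOfSingularities-20038 --as helper` by
res-L1-w45b-stub-3 (object T-CLUSTER-LIFT, part 5). No `sorry`; standard axioms.

WHAT. Part 4 (…NatClusterLiftManyPoints) proved «fat points impose independent conditions in degree `d ≥ Σ m_t − 1`» for points
of ONE standard chart `T_i ≠ 0`. res-L1-w45b-lead-2 (LEAD-MEMO-6 §3) wants the v7′ clause COORDINATE-FREE. Here every point `t`
is given on its own chart `i_t` by affine coordinates `a_t : {j ≠ i_t} → k`, i.e. by the homogeneous vector
`â_t = (l ↦ if l = i_t then 1 else a_t l)`, and «pairwise distinct points of ℙ» is «`â_{t'}` is not a multiple of `â_t`» (`t ≠ t'`).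
With that, part 4 goes through verbatim once a SEPARATING LINEAR FORM is available across charts:

* `dehomogenize_X_of_ne`, `dehomogenize_X_sub_C_mem` — `T_l(T_i := 1) ≡ â(l) (mod 𝔪_a)` for every variable `T_l`;
* **`exists_linearForm_sep_charts`** — for non-proportional `â` (chart `i`) and `b̂` (chart `i'`) a linear form `ℓ` with
  `ℓ(T_{i'} := 1) ∈ 𝔪_b` and `ℓ(T_i := 1) ≡ 1 (mod 𝔪_a)`: `ℓ = μ⁻¹ (λ T_j − ν T_i)` with `λ = b̂(i)`, `ν = b̂(j)` for a coordinate `j`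
  where `b̂(j) ≠ λ â(j)`, `μ = λ â(j) − ν` (the non-vanishing `2 × 2` minor);
* `exists_isHomogeneous_mk_eq_and_forall_mem_charts`, **`exists_isHomogeneous_forall_mk_dehomogenize_eq_charts`** (all classes
  modulo `𝔪_{a_t}^{m_t}`, each on its chart, prescribed at once when `Σ m_t ≤ d + 1`), **`exists_isHomogeneous_forall_coeff_eq_charts`**
  (= part 1's `hind` VERBATIM, general `i : ι → σ`);
* **`exists_isHomogeneous_lift_forall_dehomogenize_mem_pow_charts`** (+ `_of_isLocalRing`) — THE LIFT: `π : O ↠ k` onto a field,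
  `ker π ≤ jacobson ⊥`; finitely many `O`-points `a_t` on charts `i_t` whose reductions are PAIRWISE DISTINCT POINTS OF `ℙ`;
  `Σ_t m_t ≤ d + 1`; `g ∈ k[T_σ]_d` of order `≥ m_t` at each `ā_t` ⇒ `G ∈ O[T_σ]_d`, `map π G = g`, of order `≥ m_t` along EVERY section.
  This is the numerical, coordinate-free v7′ clause «pairwise distinct sectioned points `q_t` of the reduced trace `Z = V(g) ⊂ e`,
  `Σ mult_{q_t} Z ≤ deg g + 1`» discharged upstairs with no superabundance hypothesis.

References: parts 1–4. res-L1-w45b-lead-2 LEAD-MEMO-6 §3 (v7′ TC⁺⁺ text owed); res-L1-w45b-tri-1 XDERIVE-M1 Y3(ii) (OURS planning texts, index only).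
-/

set_option linter.dupNamespace false -- mandated namespace `Summit.<Summit>.<Problem>` of this single-conjunct summit

noncomputable section

open MvPolynomial Literature.AlgebraicGeometry.Resolution

namespace Summit.ResolutionOfSingularities.ResolutionOfSingularities.Theorems.EquisingularLiftNat.ClusterLift

/-! ## Variables under dehomogenisation, read modulo the point -/

section Var

variable {R : Type*} [CommRing R] {σ : Type*} [DecidableEq σ] (i : σ)

/-- `T_l ↦ X_l` for `l ≠ i` (unbundled index). [folklore] -/
theorem dehomogenize_X_of_ne {l : σ} (h : l ≠ i) : dehomogenize i (X l : MvPolynomial σ R) = X ⟨l, h⟩ := by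
  rw [aeval_X, killVar_of_ne i h]

/-- `T_l(T_i := 1) ≡ â(l) (mod 𝔪_a)`, where `â(l) = 1` for `l = i` and `â(l) = a_l` otherwise: the dehomogenised variable minus
the homogeneous coordinate of the point lies in the ideal of the point. [folklore] -/
theorem dehomogenize_X_sub_C_mem (a : {j : σ // j ≠ i} → R) (l : σ) :
    dehomogenize i (X l : MvPolynomial σ R) - C (if h : l = i then (1 : R) else a ⟨l, h⟩) ∈
      Ideal.span (Set.range fun j => (X j : MvPolynomial {j : σ // j ≠ i} R) - C (a j)) := by
  by_cases h : l = i
  · subst h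
    rw [dif_pos rfl, dehomogenize_X_self, map_one, sub_self]
    exact Submodule.zero_mem _
  · rw [dif_neg h, dehomogenize_X_of_ne i h]
    exact Ideal.subset_span ⟨⟨l, h⟩, rfl⟩

end Var

/-! ## The separating linear form across two charts -/

section Sep

variable {k : Type*} [Field k] {σ : Type*} [DecidableEq σ]

/-- **Separating linear form across charts.** Points `â` (chart `i`, affine coordinates `a`) and `b̂` (chart `i'`, coordinates `b`) of
`ℙ(k[T_σ])` with `b̂` NOT a multiple of `â` (distinct points): there is a linear form `ℓ` with `ℓ(T_{i'} := 1) ∈ 𝔪_b` (`ℓ` vanishes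
at `b̂`) and `ℓ(T_i := 1) ≡ 1 (mod 𝔪_a)` (`ℓ(â) = 1`). [folklore] [OURS · L1 W4.5b] -/
theorem exists_linearForm_sep_charts (i i' : σ) (a : {j : σ // j ≠ i} → k) (b : {j : σ // j ≠ i'} → k)
    (hab : ¬ ∃ c : k, (fun l : σ => if h : l = i' then (1 : k) else b ⟨l, h⟩) =
      c • (fun l : σ => if h : l = i then (1 : k) else a ⟨l, h⟩)) :
    ∃ ℓ : MvPolynomial σ k, ℓ.IsHomogeneous 1 ∧
      dehomogenize i' ℓ ∈ Ideal.span (Set.range fun j => (X j : MvPolynomial {j : σ // j ≠ i'} k) - C (b j)) ∧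
      dehomogenize i ℓ - 1 ∈ Ideal.span (Set.range fun j => (X j : MvPolynomial {j : σ // j ≠ i} k) - C (a j)) := by
  -- homogeneous coordinates of the two points
  set â : σ → k := fun l => if h : l = i then (1 : k) else a ⟨l, h⟩ with hâ
  set bh : σ → k := fun l => if h : l = i' then (1 : k) else b ⟨l, h⟩ with hbh
  -- a coordinate `j` where `b̂(j) ≠ b̂(i) · â(j)`
  have hj : ∃ j, bh j ≠ bh i * â j := by
    by_contra hcon
    exact hab ⟨bh i, funext fun l => by
      rw [Pi.smul_apply, smul_eq_mul]; exact not_not.mp (not_exists.mp hcon l)⟩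
  obtain ⟨j, hj⟩ := hj
  have hji : j ≠ i := by
    rintro rfl
    apply hj
    rw [hâ]; simp
  have hâj : â j = a ⟨j, hji⟩ := by rw [hâ]; exact dif_neg hji
  set μ : k := bh i * â j - bh j with hμ
  have hμ0 : μ ≠ 0 := fun h => hj (by rw [hμ] at h; exact (sub_eq_zero.mp h).symm)
  have hμinv : μ⁻¹ * μ = 1 := inv_mul_cancel₀ hμ0
  refine ⟨C μ⁻¹ * (C (bh i) * X j - C (bh j) * X i), ?_, ?_, ?_⟩
  · have hA : (C (bh i) * X j : MvPolynomial σ k).IsHomogeneous 1 := by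
      simpa using (isHomogeneous_C σ (bh i)).mul (isHomogeneous_X k j)
    have hB : (C (bh j) * X i : MvPolynomial σ k).IsHomogeneous 1 := by
      simpa using (isHomogeneous_C σ (bh j)).mul (isHomogeneous_X k i)
    simpa using (isHomogeneous_C σ μ⁻¹).mul (hA.sub hB)
  · -- `ℓ(T_{i'} := 1) ≡ μ⁻¹ (b̂(i) b̂(j) − b̂(j) b̂(i)) = 0 (mod 𝔪_b)`
    have key : dehomogenize i' (C μ⁻¹ * (C (bh i) * X j - C (bh j) * X i) : MvPolynomial σ k) =
        C μ⁻¹ * (C (bh i) * (dehomogenize i' (X j : MvPolynomial σ k) - C (bh j)) -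
          C (bh j) * (dehomogenize i' (X i : MvPolynomial σ k) - C (bh i))) := by
      simp only [map_mul, map_sub, algHom_C, MvPolynomial.algebraMap_eq]
      ring
    rw [key]
    exact Ideal.mul_mem_left _ _ (Ideal.sub_mem _ (Ideal.mul_mem_left _ _ (dehomogenize_X_sub_C_mem i' b j))
      (Ideal.mul_mem_left _ _ (dehomogenize_X_sub_C_mem i' b i)))
  · -- `ℓ(T_i := 1) − 1 ≡ μ⁻¹ (b̂(i) â(j) − b̂(j)) − 1 = 0 (mod 𝔪_a)`
    have hone : C μ⁻¹ * (C (bh i) * C (â j) - C (bh j) * C (â i)) = (1 : MvPolynomial {j : σ // j ≠ i} k) := by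
      have hâi : â i = 1 := by rw [hâ]; exact dif_pos rfl
      rw [hâi, map_one, mul_one, ← map_mul, ← map_sub, ← map_mul, ← hμ, hμinv, map_one]
    have key : dehomogenize i (C μ⁻¹ * (C (bh i) * X j - C (bh j) * X i) : MvPolynomial σ k) - 1 =
        C μ⁻¹ * (C (bh i) * (dehomogenize i (X j : MvPolynomial σ k) - C (â j)) -
          C (bh j) * (dehomogenize i (X i : MvPolynomial σ k) - C (â i))) := by
      simp only [map_mul, map_sub, algHom_C, MvPolynomial.algebraMap_eq]
      linear_combination hone
    rw [key]
    exact Ideal.mul_mem_left _ _ (Ideal.sub_mem _ (Ideal.mul_mem_left _ _ (dehomogenize_X_sub_C_mem i a j))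
      (Ideal.mul_mem_left _ _ (dehomogenize_X_sub_C_mem i a i)))

end Sep

/-! ## Fat points on several charts -/

section Charts

variable {k : Type*} [Field k] {σ : Type*} [Finite σ] [DecidableEq σ]
variable {ι : Type*} [Fintype ι] [DecidableEq ι] (i : ι → σ)

/-- **Prescribed class at `a_t` (chart `i_t`), inside `𝔪_{a_{t'}}^{m_{t'}}` (chart `i_{t'}`) at every other point.** Pairwise distinct
points of `ℙ`, `Σ_t m_t ≤ d + 1`. [OURS · L1 W4.5b] -/
theorem exists_isHomogeneous_mk_eq_and_forall_mem_charts (a : (t : ι) → {j : σ // j ≠ i t} → k)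
    (hdist : ∀ t t', t ≠ t' → ¬ ∃ c : k, (fun l : σ => if h : l = i t' then (1 : k) else a t' ⟨l, h⟩) =
      c • (fun l : σ => if h : l = i t then (1 : k) else a t ⟨l, h⟩))
    (m : ι → ℕ) {d : ℕ} (hd : ∑ t, m t ≤ d + 1) (t : ι)
    (c : MvPolynomial {j : σ // j ≠ i t} k ⧸
      (Ideal.span (Set.range fun j => (X j : MvPolynomial {j : σ // j ≠ i t} k) - C (a t j))) ^ m t) :
    ∃ g : MvPolynomial σ k, g.IsHomogeneous d ∧
      Ideal.Quotient.mk ((Ideal.span (Set.range fun j => (X j : MvPolynomial {j : σ // j ≠ i t} k) - C (a t j))) ^ m t)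
          (dehomogenize (i t) g) = c ∧
        ∀ t', t' ≠ t → dehomogenize (i t') g ∈
          (Ideal.span (Set.range fun j => (X j : MvPolynomial {j : σ // j ≠ i t'} k) - C (a t' j))) ^ m t' := by
  rcases Nat.eq_zero_or_pos (m t) with h0 | hpos
  · haveI : Subsingleton (MvPolynomial {j : σ // j ≠ i t} k ⧸
        (Ideal.span (Set.range fun j => (X j : MvPolynomial {j : σ // j ≠ i t} k) - C (a t j))) ^ m t) :=
      Ideal.Quotient.subsingleton_iff.mpr (by rw [h0, pow_zero, Ideal.one_eq_top])
    exact ⟨0, isHomogeneous_zero σ k d, Subsingleton.elim _ _, fun t' _ => by rw [map_zero]; exact Submodule.zero_mem _⟩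
  have hsplit : ∑ t' ∈ Finset.univ.erase t, m t' + m t = ∑ t', m t' := Finset.sum_erase_add _ _ (Finset.mem_univ t)
  set e : ℕ := ∑ t' ∈ Finset.univ.erase t, m t' with he
  have hed : e ≤ d := by omega
  have hsep : ∀ t' : ι, t' ≠ t → ∃ ℓ : MvPolynomial σ k, ℓ.IsHomogeneous 1 ∧
      dehomogenize (i t') ℓ ∈ Ideal.span (Set.range fun j => (X j : MvPolynomial {j : σ // j ≠ i t'} k) - C (a t' j)) ∧
      dehomogenize (i t) ℓ - 1 ∈ Ideal.span (Set.range fun j => (X j : MvPolynomial {j : σ // j ≠ i t} k) - C (a t j)) :=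
    fun t' ht' => exists_linearForm_sep_charts (i t) (i t') (a t) (a t') (hdist t t' (Ne.symm ht'))
  choose! ℓ hℓhom hℓmem hℓone using hsep
  set L : MvPolynomial σ k := ∏ t' ∈ Finset.univ.erase t, ℓ t' ^ m t' with hL
  have hLhom : L.IsHomogeneous e := by
    rw [hL, he]
    refine IsHomogeneous.prod _ _ _ fun t' ht' => ?_
    simpa using (hℓhom t' (Finset.ne_of_mem_erase ht')).pow (m t')
  have hLmem : ∀ t', t' ≠ t → dehomogenize (i t') L ∈
      (Ideal.span (Set.range fun j => (X j : MvPolynomial {j : σ // j ≠ i t'} k) - C (a t' j))) ^ m t' := by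
    intro t' ht'
    rw [hL, map_prod, ← Finset.mul_prod_erase _ _ (Finset.mem_erase.mpr ⟨ht', Finset.mem_univ t'⟩), map_pow]
    exact Ideal.mul_mem_right _ _ (Ideal.pow_mem_pow (hℓmem t' ht') (m t'))
  obtain ⟨u, hu⟩ : IsUnit (Ideal.Quotient.mk
      ((Ideal.span (Set.range fun j => (X j : MvPolynomial {j : σ // j ≠ i t} k) - C (a t j))) ^ m t)
        (dehomogenize (i t) L)) := by
    rw [hL, map_prod, map_prod]
    refine Finset.prod_induction _ _ (fun x y hx hy => hx.mul hy) isUnit_one fun t' ht' => ?_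
    rw [map_pow, map_pow]
    exact (isUnit_mk_pow_of_sub_one_mem _ (m t) (hℓone t' (Finset.ne_of_mem_erase ht'))).pow _
  obtain ⟨h, hh, hhc⟩ := exists_isHomogeneous_mk_dehomogenize_eq (i t) (a t) (m := m t) (d := d - e) (by omega) (↑u⁻¹ * c)
  refine ⟨L * h, ?_, ?_, fun t' ht' => ?_⟩
  · have := hLhom.mul hh
    rwa [Nat.add_sub_cancel' hed] at this
  · rw [map_mul, map_mul, hhc, ← hu, Units.mul_inv_cancel_left]
  · rw [map_mul]
    exact Ideal.mul_mem_right _ _ (hLmem t' ht')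

/-- **FAT POINTS ON SEVERAL CHARTS IMPOSE INDEPENDENT CONDITIONS IN DEGREE `d ≥ Σ m_t − 1` (quotient currency).** Pairwise distinct
points of `ℙ(k[T_σ])` (each on its chart `i_t`), `Σ_t m_t ≤ d + 1`: every family of classes `c_t` modulo `𝔪_{a_t}^{m_t}` is realised by
`g(T_{i_t} := 1)` for ONE degree-`d` form `g`. [folklore] [OURS · L1 W4.5b] -/
theorem exists_isHomogeneous_forall_mk_dehomogenize_eq_charts (a : (t : ι) → {j : σ // j ≠ i t} → k)
    (hdist : ∀ t t', t ≠ t' → ¬ ∃ c : k, (fun l : σ => if h : l = i t' then (1 : k) else a t' ⟨l, h⟩) =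
      c • (fun l : σ => if h : l = i t then (1 : k) else a t ⟨l, h⟩))
    (m : ι → ℕ) {d : ℕ} (hd : ∑ t, m t ≤ d + 1)
    (c : (t : ι) → MvPolynomial {j : σ // j ≠ i t} k ⧸
      (Ideal.span (Set.range fun j => (X j : MvPolynomial {j : σ // j ≠ i t} k) - C (a t j))) ^ m t) :
    ∃ g : MvPolynomial σ k, g.IsHomogeneous d ∧ ∀ t,
      Ideal.Quotient.mk ((Ideal.span (Set.range fun j => (X j : MvPolynomial {j : σ // j ≠ i t} k) - C (a t j))) ^ m t)
        (dehomogenize (i t) g) = c t := by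
  choose g hg hgc hgo using fun t => exists_isHomogeneous_mk_eq_and_forall_mem_charts i a hdist m hd t (c t)
  refine ⟨∑ t, g t, IsHomogeneous.sum _ _ _ (fun t _ => hg t), fun t => ?_⟩
  rw [map_sum, map_sum, ← Finset.add_sum_erase _ _ (Finset.mem_univ t), hgc t,
    Finset.sum_eq_zero (fun t' ht' => Ideal.Quotient.eq_zero_iff_mem.mpr (hgo t' t (Finset.ne_of_mem_erase ht').symm)),
    add_zero]

/-- **FAT POINTS ON SEVERAL CHARTS, jet currency** = part 1's INDEPENDENCE hypothesis `hind` VERBATIM (general charts `i : ι → σ`) for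
pairwise distinct points of `ℙ` with `Σ_t m_t ≤ d + 1`. [folklore] [OURS · L1 W4.5b] -/
theorem exists_isHomogeneous_forall_coeff_eq_charts (a : (t : ι) → {j : σ // j ≠ i t} → k)
    (hdist : ∀ t t', t ≠ t' → ¬ ∃ c : k, (fun l : σ => if h : l = i t' then (1 : k) else a t' ⟨l, h⟩) =
      c • (fun l : σ => if h : l = i t then (1 : k) else a t ⟨l, h⟩))
    (m : ι → ℕ) {d : ℕ} (hd : ∑ t, m t ≤ d + 1) (v : (t : ι) → ({j : σ // j ≠ i t} →₀ ℕ) → k) :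
    ∃ g : MvPolynomial σ k, g.IsHomogeneous d ∧ ∀ t (α : {j : σ // j ≠ i t} →₀ ℕ), α.degree < m t →
      coeff α (aeval (fun j => (X j : MvPolynomial {j : σ // j ≠ i t} k) + C (a t j)) (dehomogenize (i t) g)) = v t α := by
  classical
  haveI : ∀ t, Fintype {α : {j : σ // j ≠ i t} →₀ ℕ // α.degree < m t} :=
    fun t => @Fintype.ofFinite _ (finite_subtype_degree_lt (m t))
  let S : (t : ι) → Finset ({j : σ // j ≠ i t} →₀ ℕ) := fun t =>
    Finset.univ.map (Function.Embedding.subtype fun α : {j : σ // j ≠ i t} →₀ ℕ => α.degree < m t)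
  have hS : ∀ t (α : {j : σ // j ≠ i t} →₀ ℕ), α.degree < m t → α ∈ S t := fun t α hα => by
    simp only [S, Finset.mem_map, Finset.mem_univ, Function.Embedding.coe_subtype, true_and, Subtype.exists,
      exists_prop, exists_eq_right]; exact hα
  let J : (t : ι) → MvPolynomial {j : σ // j ≠ i t} k := fun t =>
    aeval (fun l => (X l : MvPolynomial {j : σ // j ≠ i t} k) - C (a t l)) (∑ β ∈ S t, monomial β (v t β))
  obtain ⟨g, hg, hgc⟩ := exists_isHomogeneous_forall_mk_dehomogenize_eq_charts i a hdist m hd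
    fun t => Ideal.Quotient.mk _ (J t)
  refine ⟨g, hg, fun t α hα => ?_⟩
  rw [coeff_eq_of_sub_mem_pow_span_X_sub_C (a t) (m t) (Ideal.Quotient.eq.mp (hgc t)) α hα]
  exact coeff_aeval_X_add_C_jetPoly (a t) (S t) (v t) (hS t α hα)

end Charts

/-! ## The coordinate-free cluster lift -/

section ChartsLift

variable {O k : Type*} [CommRing O] [Field k] (π : O →+* k) {σ : Type*} [Finite σ] [DecidableEq σ]
variable {ι : Type*} [Fintype ι] [DecidableEq ι]

/-- **THE CLUSTER LIFT, MULTI-CHART FORM.** `π : O ↠ k` onto a field, `ker π ≤ jacobson ⊥` (e.g. `O` local); finitely many `O`-points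
(sections) `a_t` read on charts `i_t` whose REDUCTIONS ARE PAIRWISE DISTINCT POINTS OF `ℙ` (the reduced homogeneous vectors are not
proportional); `Σ_t m_t ≤ d + 1`; `g ∈ k[T_σ]` a form of degree `d` of order `≥ m_t` at every `ā_t` (`g(T_{i_t} := 1) ∈ 𝔪_{ā_t}^{m_t}`).
THEN there is a form `G ∈ O[T_σ]_d` with `map π G = g` and `G(T_{i_t} := 1) ∈ 𝔪_{a_t}^{m_t}` for EVERY `t` — the upstairs discharge of
the numerical v7′ clause «pairwise distinct sectioned points with `Σ mult ≤ deg + 1`», no superabundance hypothesis. [OURS · L1 W4.5b] -/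
theorem exists_isHomogeneous_lift_forall_dehomogenize_mem_pow_charts (hπ : Function.Surjective π)
    (hker : RingHom.ker π ≤ (⊥ : Ideal O).jacobson) {d : ℕ} (i : ι → σ) (a : (t : ι) → {j : σ // j ≠ i t} → O)
    (hdist : ∀ t t', t ≠ t' → ¬ ∃ c : k, (fun l : σ => if h : l = i t' then (1 : k) else π (a t' ⟨l, h⟩)) =
      c • (fun l : σ => if h : l = i t then (1 : k) else π (a t ⟨l, h⟩)))
    (m : ι → ℕ) (hd : ∑ t, m t ≤ d + 1) (g : MvPolynomial σ k) (hg : g.IsHomogeneous d)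
    (hgZ : ∀ t, dehomogenize (i t) g ∈
      (Ideal.span (Set.range fun j => (X j : MvPolynomial {j : σ // j ≠ i t} k) - C (π (a t j)))) ^ m t) :
    ∃ G : MvPolynomial σ O, G.IsHomogeneous d ∧ MvPolynomial.map π G = g ∧
      ∀ t, dehomogenize (i t) G ∈
        (Ideal.span (Set.range fun j => (X j : MvPolynomial {j : σ // j ≠ i t} O) - C (a t j))) ^ m t :=
  exists_isHomogeneous_lift_forall_dehomogenize_mem_pow π hπ hker i a m
    (fun v => exists_isHomogeneous_forall_coeff_eq_charts i (fun t j => π (a t j)) hdist m hd v) g hg hgZ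

/-- **The multi-chart cluster lift over a local ring** (the chain's DVR `O`, residue map `π : O ↠ k`). [OURS · L1 W4.5b] -/
theorem exists_isHomogeneous_lift_forall_dehomogenize_mem_pow_charts_of_isLocalRing [IsLocalRing O]
    (hπ : Function.Surjective π) {d : ℕ} (i : ι → σ) (a : (t : ι) → {j : σ // j ≠ i t} → O)
    (hdist : ∀ t t', t ≠ t' → ¬ ∃ c : k, (fun l : σ => if h : l = i t' then (1 : k) else π (a t' ⟨l, h⟩)) =
      c • (fun l : σ => if h : l = i t then (1 : k) else π (a t ⟨l, h⟩)))
    (m : ι → ℕ) (hd : ∑ t, m t ≤ d + 1) (g : MvPolynomial σ k) (hg : g.IsHomogeneous d)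
    (hgZ : ∀ t, dehomogenize (i t) g ∈
      (Ideal.span (Set.range fun j => (X j : MvPolynomial {j : σ // j ≠ i t} k) - C (π (a t j)))) ^ m t) :
    ∃ G : MvPolynomial σ O, G.IsHomogeneous d ∧ MvPolynomial.map π G = g ∧
      ∀ t, dehomogenize (i t) G ∈
        (Ideal.span (Set.range fun j => (X j : MvPolynomial {j : σ // j ≠ i t} O) - C (a t j))) ^ m t :=
  exists_isHomogeneous_lift_forall_dehomogenize_mem_pow_charts π hπ (ker_le_jacobson_bot_of_isLocalRing π) i a hdist m hd
    g hg hgZ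

end ChartsLift

end Summit.ResolutionOfSingularities.ResolutionOfSingularities.Theorems.EquisingularLiftNat.ClusterLift

end
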